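import Mathlib
import Literature.MathematicalPhysics.QuantumManyBody.BoseEinsteinCondensation
import Summits.AtomisticToContinuum.BoseEinsteinCondensation.Theorems.SoloBlindBhattacharyya
import Summits.AtomisticToContinuum.BoseEinsteinCondensation.Theorems.SoloBlindTrialStateCriterion
import Summits.AtomisticToContinuum.BoseEinsteinCondensation.Theorems.SoloBlindMutualInformation
import Summits.AtomisticToContinuum.BoseEinsteinCondensation.Theorems.SoloBlindOccupationStability

/-!
# A conditional route to `HasGroundStateBEC`: affinity of positive comparison amplitudes

Solo seat `solo-AtomisticToContinuum-blind`, conjunct `BoseEinsteinCondensation`.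

This file assembles the `SoloBlind*` criteria into a theorem whose conclusion is literally
`BoseGas.HasGroundStateBEC v ρ`.  The hypothesis is the typed form of

* (identification input, finite volume) every sufficiently good near-minimiser `Ψ` of the
  `N`-body energy is `L²`-close, *modulo a global phase* `c`, to some nonnegative amplitude `Φ`
  (for the true system: the Perron–Frobenius ground state), and
* (the open conjecture J of the accompanying paper, with a margin) these nonnegative amplitudes have
  Bhattacharyya affinity `≥ b` to their resampling by some normalised one-particle mode `g ≥ 0`,

with `ε < b` uniformly in `N`.  Then `condensateNumber ≥ (b − ε)² · N` eventually, i.e. BEC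
(`hasGroundStateBEC_of_near_positive`).  Ingredients: phase invariance of the occupation, the
affinity lower bound with the parametric integrability discharged almost everywhere, the
`L²`-stability of the occupation, and `BoseGas.le_condensateNumber`.
-/

open MeasureTheory Filter
open scoped ENNReal

namespace Summit.AtomisticToContinuum.BoseEinsteinCondensation.Theorems

open Literature.MathematicalPhysics.QuantumManyBody.BoseGas

/-- Phase invariance: multiplying the amplitude by a unimodular constant does not change the
occupation of any mode. -/
theorem occupation_const_mul {n : ℕ} (φ : Space → ℂ) (Ψ : Config (n + 1) → ℂ) {c : ℂ}
    (hc : ‖c‖ = 1) :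
    occupation (n + 1) φ (fun X => c * Ψ X) = occupation (n + 1) φ Ψ := by
  simp only [occupation]
  congr 1
  refine lintegral_congr fun Y => ?_
  have h : ∫ x, (starRingEnd ℂ) (φ x) * (c * Ψ (Matrix.vecCons x Y)) =
      c * ∫ x, (starRingEnd ℂ) (φ x) * Ψ (Matrix.vecCons x Y) := by
    rw [← integral_const_mul]
    refine integral_congr_ae (ae_of_all _ fun x => ?_)
    ring
  rw [h, nnnorm_mul]
  have hc' : ‖c‖₊ = 1 := by ext; simp [hc]
  rw [hc', one_mul]

/-- The affinity lower bound for the occupation of a specific mode `g`, with the parametric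
integrability discharged almost everywhere: `(n+1) · BC(g²⊗P̂, Φ²)² ≤ occupation (n+1) g Φ` for
normalised `g, Φ ≥ 0`. -/
theorem bhattacharyya_sq_le_occupation_ae {n : ℕ} {g : Space → ℝ} {Φ : Config (n + 1) → ℝ}
    (hg0 : 0 ≤ g) (hΦ0 : 0 ≤ Φ) (hgm : Measurable g) (hΦm : Measurable Φ)
    (hg1 : ∫⁻ x, ENNReal.ofReal (g x) ^ 2 = 1)
    (hΦ1 : ∫⁻ Y : Config n, ∫⁻ x, ENNReal.ofReal (Φ (Matrix.vecCons x Y)) ^ 2 = 1) :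
    (n + 1 : ℝ≥0∞) *
        (∫⁻ Y : Config n, (∫⁻ x, ENNReal.ofReal (g x) * ENNReal.ofReal (Φ (Matrix.vecCons x Y))) *
          (∫⁻ x, ENNReal.ofReal (Φ (Matrix.vecCons x Y)) ^ 2) ^ (1 / 2 : ℝ)) ^ 2 ≤
      occupation (n + 1) (fun x => (g x : ℂ)) (fun X => (Φ X : ℂ)) := by
  have hint := ae_integrable_mul_vecCons hg0 hΦ0 hgm hΦm hg1 hΦ1
  have hΨ : Measurable (Function.uncurry fun (x : Space) (Y : Config n) =>
      ENNReal.ofReal (Φ (Matrix.vecCons x Y))) :=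
    ENNReal.measurable_ofReal.comp (hΦm.comp measurable_vecCons)
  have hφ : Measurable fun x => ENNReal.ofReal (g x) := ENNReal.measurable_ofReal.comp hgm
  have h := bhattacharyya_sandwich (volume : Measure Space) (volume : Measure (Config n))
    hΨ hφ hg1.le hΦ1
  rw [occupation_ofReal_eq_ae hg0 hΦ0 hint]
  exact mul_le_mul' le_rfl h.1

/-- For `g ≥ 0` square-normalised and `Ψ ∈ L²`, the pairing `x ↦ conj (g x) · Ψ (x :: Y)` is
integrable for almost every `Y`. -/
theorem ae_integrable_conj_mul_vecCons {n : ℕ} {g : Space → ℝ} {Ψ : Config (n + 1) → ℂ}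
    (hg0 : 0 ≤ g) (hgm : Measurable g) (hg1 : ∫⁻ x, ENNReal.ofReal (g x) ^ 2 = 1)
    (hΨm : Measurable Ψ) (hΨ2 : ∫⁻ X, (‖Ψ X‖₊ : ℝ≥0∞) ^ 2 ≠ ⊤) :
    ∀ᵐ Y : Config n, Integrable (fun x => (starRingEnd ℂ) ((g x : ℂ)) * Ψ (Matrix.vecCons x Y)) := by
  have hmeas : Measurable fun X : Config (n + 1) => (‖Ψ X‖₊ : ℝ≥0∞) ^ 2 :=
    hΨm.nnnorm.coe_nnreal_ennreal.pow_const 2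
  rw [lintegral_eq_lintegral_lintegral_vecCons hmeas] at hΨ2
  have hY : Measurable fun Y : Config n => ∫⁻ x, (‖Ψ (Matrix.vecCons x Y)‖₊ : ℝ≥0∞) ^ 2 :=
    ((hΨm.comp measurable_vecCons).nnnorm.coe_nnreal_ennreal.pow_const 2).lintegral_prod_left'
  filter_upwards [ae_lt_top hY hΨ2] with Y hYlt
  have hΨY : Measurable fun x : Space => Ψ (Matrix.vecCons x Y) :=
    hΨm.comp (measurable_vecCons.comp (measurable_id.prodMk measurable_const))
  have hG : Integrable (fun x => g x * ‖Ψ (Matrix.vecCons x Y)‖) := by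
    refine integrable_mul_of_lintegral_sq_ne_top volume hg0 (fun x => norm_nonneg _) hgm
      hΨY.norm (hg1.trans_ne ENNReal.one_ne_top) ?_
    refine ne_of_lt (lt_of_le_of_lt (le_of_eq (lintegral_congr fun x => ?_)) hYlt)
    rw [ofReal_norm]
    rfl
  refine hG.mono' ?_ (ae_of_all _ fun x => ?_)
  · exact ((Complex.continuous_conj.measurable.comp
      (Complex.measurable_ofReal.comp hgm)).mul hΨY).aestronglyMeasurable
  · rw [norm_mul, RCLike.norm_conj, Complex.norm_real, Real.norm_of_nonneg (hg0 x)]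

/-- **Occupation of an amplitude near a positive one, modulo phase.** If `Φ ≥ 0` (normalised) has
affinity `≥ b` to its resampling by the normalised mode `g ≥ 0`, and `Ψ ∈ L²` satisfies
`‖Ψ − c Φ‖_{L²} ≤ ε` for some unimodular `c`, then `(n+1)(b − ε)² ≤ maxOccupation (n+1) Ψ`. -/
theorem mul_sq_sub_le_maxOccupation_of_near_phase {n : ℕ} {g : Space → ℝ}
    {Φ : Config (n + 1) → ℝ} {Ψ : Config (n + 1) → ℂ} {c : ℂ}
    (hg0 : 0 ≤ g) (hΦ0 : 0 ≤ Φ) (hgm : Measurable g) (hΦm : Measurable Φ) (hΨm : Measurable Ψ)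
    (hΨ2 : ∫⁻ X, (‖Ψ X‖₊ : ℝ≥0∞) ^ 2 ≠ ⊤) (hc : ‖c‖ = 1)
    (hg1 : ∫⁻ x, ENNReal.ofReal (g x) ^ 2 = 1)
    (hΦ1 : ∫⁻ Y : Config n, ∫⁻ x, ENNReal.ofReal (Φ (Matrix.vecCons x Y)) ^ 2 = 1) {b ε : ℝ≥0∞}
    (hb : b ≤ ∫⁻ Y : Config n, (∫⁻ x, ENNReal.ofReal (g x) * ENNReal.ofReal (Φ (Matrix.vecCons x Y))) *
          (∫⁻ x, ENNReal.ofReal (Φ (Matrix.vecCons x Y)) ^ 2) ^ (1 / 2 : ℝ))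
    (hε : ∫⁻ X, (‖Ψ X - c * Φ X‖₊ : ℝ≥0∞) ^ 2 ≤ ε ^ 2) :
    (n + 1 : ℝ≥0∞) * (b - ε) ^ 2 ≤ maxOccupation (n + 1) Ψ := by
  -- the occupation of `g` in `c Φ` is at least `(n+1) b²`
  have hoccΦ : (n + 1 : ℝ≥0∞) * b ^ 2 ≤
      occupation (n + 1) (fun x => (g x : ℂ)) (fun X => c * (Φ X : ℂ)) := by
    rw [occupation_const_mul _ _ hc]
    exact le_trans (mul_le_mul' le_rfl (pow_le_pow_left' hb 2))
      (bhattacharyya_sq_le_occupation_ae hg0 hΦ0 hgm hΦm hg1 hΦ1)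
  -- stability between `c Φ` and `Ψ`
  have hφm : Measurable fun x => (g x : ℂ) := Complex.measurable_ofReal.comp hgm
  have hcΦm : Measurable fun X => c * (Φ X : ℂ) :=
    (Complex.measurable_ofReal.comp hΦm).const_mul c
  have hφ1 : ∫⁻ x, (‖(g x : ℂ)‖₊ : ℝ≥0∞) ^ 2 ≤ 1 := by
    rw [← hg1]
    refine le_of_eq (lintegral_congr fun x => ?_)
    rw [coe_nnnorm_ofReal_of_nonneg (hg0 x)]
  have hcΦ2 : ∫⁻ X, (‖c * (Φ X : ℂ)‖₊ : ℝ≥0∞) ^ 2 ≠ ⊤ := by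
    have hmeas : Measurable fun X : Config (n + 1) => (‖c * (Φ X : ℂ)‖₊ : ℝ≥0∞) ^ 2 :=
      hcΦm.nnnorm.coe_nnreal_ennreal.pow_const 2
    rw [lintegral_eq_lintegral_lintegral_vecCons hmeas]
    refine ne_of_eq_of_ne ?_ ENNReal.one_ne_top
    rw [← hΦ1]
    refine lintegral_congr fun Y => lintegral_congr fun x => ?_
    have hc' : ‖c‖₊ = 1 := by ext; simp [hc]
    rw [nnnorm_mul, hc', one_mul, coe_nnnorm_ofReal_of_nonneg (hΦ0 _)]
  have hintΦ := ae_integrable_conj_mul_vecCons (n := n) hg0 hgm hg1 hcΦm hcΦ2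
  have hintΨ := ae_integrable_conj_mul_vecCons (n := n) hg0 hgm hg1 hΨm hΨ2
  have hstab := sqrt_occupation_le_add hφm hcΦm hΨm hφ1 hintΦ hintΨ
  have hε' : ∫⁻ X, (‖c * (Φ X : ℂ) - Ψ X‖₊ : ℝ≥0∞) ^ 2 ≤ ε ^ 2 :=
    le_trans (le_of_eq (lintegral_congr fun X => by rw [← nnnorm_neg, neg_sub])) hε
  -- `√(n+1) b ≤ √occ(cΦ) ≤ √occ(Ψ) + √(n+1) ε`
  have h1 : ((n + 1 : ℝ≥0∞) * b ^ 2) ^ (1 / 2 : ℝ) ≤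
      occupation (n + 1) (fun x => (g x : ℂ)) Ψ ^ (1 / 2 : ℝ) +
        ((n + 1 : ℝ≥0∞) * ε ^ 2) ^ (1 / 2 : ℝ) := by
    refine (ENNReal.rpow_le_rpow hoccΦ (by norm_num)).trans (hstab.trans (add_le_add le_rfl ?_))
    exact ENNReal.rpow_le_rpow (mul_le_mul' le_rfl hε') (by norm_num)
  have hsq : ∀ d : ℝ≥0∞, ((n + 1 : ℝ≥0∞) * d ^ 2) ^ (1 / 2 : ℝ) =
      (n + 1 : ℝ≥0∞) ^ (1 / 2 : ℝ) * d := by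
    intro d
    rw [ENNReal.mul_rpow_of_nonneg _ _ (by norm_num : (0 : ℝ) ≤ 1 / 2), ← ENNReal.rpow_two,
      ← ENNReal.rpow_mul]
    norm_num
  rw [hsq, hsq] at h1
  have h2 : (n + 1 : ℝ≥0∞) ^ (1 / 2 : ℝ) * (b - ε) ≤
      occupation (n + 1) (fun x => (g x : ℂ)) Ψ ^ (1 / 2 : ℝ) := by
    rw [ENNReal.mul_sub (fun _ _ => by simp)]
    exact tsub_le_iff_right.mpr h1
  have h3 : ((n + 1 : ℝ≥0∞) ^ (1 / 2 : ℝ) * (b - ε)) ^ 2 ≤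
      occupation (n + 1) (fun x => (g x : ℂ)) Ψ := by
    have := pow_le_pow_left' h2 2
    rwa [← ENNReal.rpow_two (occupation _ _ _ ^ (1 / 2 : ℝ)), ← ENNReal.rpow_mul,
      show (1 / 2 : ℝ) * 2 = 1 by norm_num, ENNReal.rpow_one] at this
  have h4 : ((n + 1 : ℝ≥0∞) ^ (1 / 2 : ℝ) * (b - ε)) ^ 2 = (n + 1 : ℝ≥0∞) * (b - ε) ^ 2 := by
    rw [mul_pow, ← ENNReal.rpow_two ((n + 1 : ℝ≥0∞) ^ (1 / 2 : ℝ)), ← ENNReal.rpow_mul]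
    norm_num
  rw [h4] at h3
  refine h3.trans (occupation_le_maxOccupation _ ?_ ?_)
  · exact hφm.aestronglyMeasurable
  · rw [← hg1]
    refine lintegral_congr fun x => ?_
    rw [coe_nnnorm_ofReal_of_nonneg (hg0 x)]

/-- **Conditional BEC.** Suppose that for all large `N = n+1` there is `δ > 0` such that every
trial state `Ψ` with energy `≤ E₀ + δ` is within `L²`-distance `ε`, modulo a unimodular constant `c`,
of some nonnegative normalised amplitude `Φ` having Bhattacharyya affinity `≥ b` to its resampling
by some normalised one-particle mode `g ≥ 0`, where `ε < b < ∞` do not depend on `N`.  Then the gas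
has ground-state BEC at density `ρ`: `condensateNumber ≥ (b − ε)² N` eventually. -/
theorem hasGroundStateBEC_of_near_positive (v : ℝ → ℝ≥0∞) (ρ : ℝ) {b ε : ℝ≥0∞} (hεb : ε < b)
    (hb : b ≠ ⊤)
    (h : ∀ᶠ n : ℕ in atTop, ∃ δ : ℝ≥0∞, 0 < δ ∧
      ∀ Ψ : TrialState (n + 1) (sideLength ρ (n + 1)),
        energy v Ψ ≤ groundStateEnergy v (n + 1) (sideLength ρ (n + 1)) + δ →
        ∃ (g : Space → ℝ) (Φ : Config (n + 1) → ℝ) (c : ℂ),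
          0 ≤ g ∧ 0 ≤ Φ ∧ Measurable g ∧ Measurable Φ ∧ ‖c‖ = 1 ∧
          ∫⁻ x, ENNReal.ofReal (g x) ^ 2 = 1 ∧
          ∫⁻ Y : Config n, ∫⁻ x, ENNReal.ofReal (Φ (Matrix.vecCons x Y)) ^ 2 = 1 ∧
          b ≤ ∫⁻ Y : Config n,
              (∫⁻ x, ENNReal.ofReal (g x) * ENNReal.ofReal (Φ (Matrix.vecCons x Y))) *
                (∫⁻ x, ENNReal.ofReal (Φ (Matrix.vecCons x Y)) ^ 2) ^ (1 / 2 : ℝ) ∧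
          ∫⁻ X, (‖Ψ.ψ X - c * Φ X‖₊ : ℝ≥0∞) ^ 2 ≤ ε ^ 2) :
    HasGroundStateBEC v ρ := by
  have hbe : b - ε ≠ ⊤ := ENNReal.sub_ne_top hb
  have hpos : 0 < b - ε := tsub_pos_of_lt hεb
  have hsq_ne_top : (b - ε) ^ 2 ≠ ⊤ := ENNReal.pow_ne_top hbe
  refine ⟨((b - ε) ^ 2).toReal, ENNReal.toReal_pos (pow_ne_zero 2 hpos.ne') hsq_ne_top, ?_⟩
  rw [Filter.eventually_atTop] at h ⊢
  obtain ⟨n₀, hn₀⟩ := h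
  refine ⟨n₀ + 1, fun N hN => ?_⟩
  obtain ⟨n, rfl⟩ : ∃ n, N = n + 1 := ⟨N - 1, by omega⟩
  obtain ⟨δ, hδ, hΨ⟩ := hn₀ n (by omega)
  refine le_condensateNumber v hδ fun Ψ hE => ?_
  obtain ⟨g, Φ, c, hg0, hΦ0, hgm, hΦm, hc, hg1, hΦ1, hbBC, hε⟩ := hΨ Ψ hE
  have key := mul_sq_sub_le_maxOccupation_of_near_phase hg0 hΦ0 hgm hΦm
    Ψ.contDiff.continuous.measurable (Ψ.norm_eq.trans_ne ENNReal.one_ne_top) hc hg1 hΦ1 hbBC hε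
  calc ENNReal.ofReal (((b - ε) ^ 2).toReal * ((n + 1 : ℕ) : ℝ))
      = (n + 1 : ℝ≥0∞) * (b - ε) ^ 2 := by
        rw [ENNReal.ofReal_mul ENNReal.toReal_nonneg, ENNReal.ofReal_toReal hsq_ne_top,
          ENNReal.ofReal_natCast, mul_comm]
        push_cast
        rfl
    _ ≤ maxOccupation (n + 1) Ψ.ψ := key

end Summit.AtomisticToContinuum.BoseEinsteinCondensation.Theorems
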